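import Summits.Ventures.PercRepro.GenQRankStepBounds
import Summits.Ventures.PercRepro.GenQFlatRows

/-!
# PercRepro — NO BAD SETS ON A BIG FLAT: the `(Rta)` row's per-flat constant at every rank (night-4, gen 7)

For a rank-`r` flat `F` of the rank-`q` set `G` and a `t`-subset `A ⊆ F ∩ G` whose complement `G ∖ A` does NOT span
`G`, the hyperplane `H = cl(G ∖ A)` misses a point of `F`, so `F ∩ H` is a flat of rank `≤ r − 1` containing
`(F ∩ G) ∖ A` — which therefore has `≤ f(r − 1)` points (`card_le_of_bad`).  Hence when `|F ∩ G| > t + f(r − 1)` EVERY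
rank-`r` `t`-subset of `F ∩ G` is good (`goodSets_eq_rkSets_of_large`), and the `(Rta)` template of `GenQFlatRows` takes
the `(Rtb)` constant itself: on the core at `t = 6` (rank-`5` flats, `f(4) = 10`) for `|F ∩ G| ≥ 17`,
**`twenty_mul_choose_six_le_good`**: `20·C(s, 6) ≤ 20·#goodSets + 50·C(s, 4) + 2·C(s, 3)` — the generic half of the
`(R6a)` row of record one rank up (the `(8, 6)` row `(R5a)` needed the solid knapsack because `s ≤ 10 < 5 + f(3)`
there).  Imports `GenQRankStepBounds`, `GenQFlatRows`.
-/
namespace PercRepro.Night4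

open Finset ThmH SixFour GenQ PerFlat Star NightThree

variable {α : Type} [DecidableEq α] {M : Matroid α} [M.Finite]

/-- **A bad `t`-subset of `F ∩ G` leaves `≤ f(r − 1)` points of `F ∩ G` outside it** (`F ∈ flatsQ M r`, `1 ≤ r < q`,
`G ⊆ gr M` of rank `q`, size chain `f`). -/
theorem card_le_of_bad {q : ℕ} {f : ℕ → ℕ} (hf : SizeChain M q f) {G F A : Finset α} (hG : G ⊆ gr M)
    (hrG : M.eRk (G : Set α) = (q : ℕ∞)) {r : ℕ} (hF : F ∈ flatsQ M r) (hr : 1 ≤ r) (hrq : r < q)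
    (hA : A ⊆ F ∩ G) (hbad : G \ A ∉ Rq M G q) : (F ∩ G).card ≤ A.card + f (r - 1) := by
  have hF' := mem_flatsQ.1 hF
  have hGA : G \ A ⊆ G := Finset.sdiff_subset
  have hrH : M.eRk ((G \ A : Finset α) : Set α) < (q : ℕ∞) := by
    have hle : M.eRk ((G \ A : Finset α) : Set α) ≤ (q : ℕ∞) := by
      rw [← hrG]
      exact M.eRk_mono (Finset.coe_subset.2 hGA)
    exact lt_of_le_of_ne hle (fun h => hbad (mem_Rq.2 ⟨hGA, h⟩))
  set H := clF M (G \ A) with hHdef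
  have hHflat : M.IsFlat (H : Set α) := by
    rw [hHdef, coe_clF]
    exact M.isFlat_closure _
  have hGAH : G \ A ⊆ H := by
    intro x hx
    rw [hHdef, ← Finset.mem_coe, coe_clF]
    have hxE : x ∈ M.E := by
      rw [← coe_gr M]
      exact Finset.mem_coe.2 (hG (Finset.mem_sdiff.1 hx).1)
    exact M.mem_closure_of_mem' (Finset.mem_coe.2 hx) hxE
  have hFH : ¬ F ⊆ H := by
    intro hFH
    have hGH : G ⊆ H := by
      intro x hx
      by_cases hxA : x ∈ A
      · exact hFH (Finset.mem_inter.1 (hA hxA)).1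
      · exact hGAH (Finset.mem_sdiff.2 ⟨hx, hxA⟩)
    have h1 : M.eRk (G : Set α) ≤ M.eRk (H : Set α) := M.eRk_mono (Finset.coe_subset.2 hGH)
    rw [hHdef, coe_clF, M.eRk_closure_eq, hrG] at h1
    exact absurd (lt_of_le_of_lt h1 hrH) (lt_irrefl _)
  set X := (F ∩ G) \ A with hXdef
  have hXF : X ⊆ F := Finset.sdiff_subset.trans Finset.inter_subset_left
  have hXH : X ⊆ H := by
    intro x hx
    rw [hXdef, Finset.mem_sdiff, Finset.mem_inter] at hx
    exact hGAH (Finset.mem_sdiff.2 ⟨hx.1.2, hx.2⟩)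
  have hXg : X ⊆ gr M := hXF.trans hF'.1
  -- `X` has rank `< r`: otherwise `cl(X) = F ⊆ cl(H) = H`
  have hXr : M.eRk (X : Set α) ≤ ((r - 1 : ℕ) : ℕ∞) := by
    obtain ⟨a, ha⟩ := exists_eRk_eq_nat (M := M) X
    have har : a ≤ r := by
      have : M.eRk (X : Set α) ≤ (r : ℕ∞) := by
        rw [← hF'.2.2]
        exact M.eRk_mono (Finset.coe_subset.2 hXF)
      rw [ha] at this
      exact_mod_cast this
    by_cases hlt : a ≤ r - 1
    · rw [ha]
      exact_mod_cast hlt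
    · exfalso
      have har' : a = r := by omega
      have hcl := (M.isRkFinite_of_finite (Finset.finite_toSet X)).closure_eq_closure_of_subset_of_eRk_ge_eRk
        (Finset.coe_subset.2 hXF) (by rw [hF'.2.2, ha, har'])
      rw [hF'.2.1.closure] at hcl
      apply hFH
      intro x hx
      have hx' : x ∈ (F : Set α) := Finset.mem_coe.2 hx
      rw [← hcl] at hx'
      have hx'' : x ∈ M.closure (H : Set α) := M.closure_subset_closure (Finset.coe_subset.2 hXH) hx'
      rw [hHflat.closure] at hx''
      exact Finset.mem_coe.1 hx''
  have hXc := hf X hXg (r - 1) (by omega) hXr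
  have hcard : X.card = (F ∩ G).card - A.card := by
    rw [hXdef]
    exact Finset.card_sdiff_of_subset hA
  omega

/-- **On a big flat every rank-`r` `t`-subset is good**: for `|F ∩ G| > t + f(r − 1)`,
`goodSets M G F q t r = rkSets M (F ∩ G) r t`. -/
theorem goodSets_eq_rkSets_of_large {q : ℕ} {f : ℕ → ℕ} (hf : SizeChain M q f) {G F : Finset α} (hG : G ⊆ gr M)
    (hrG : M.eRk (G : Set α) = (q : ℕ∞)) {r t : ℕ} (hF : F ∈ flatsQ M r) (hr : 1 ≤ r) (hrq : r < q)
    (hbig : t + f (r - 1) < (F ∩ G).card) : goodSets M G F q t r = rkSets M (F ∩ G) r t := by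
  ext A
  unfold goodSets
  rw [Finset.mem_filter, Finset.mem_powersetCard, mem_rkSets]
  constructor
  · rintro ⟨⟨hA, hAc⟩, hAr, _⟩
    exact ⟨hA, hAc, hAr⟩
  · rintro ⟨hA, hAc, hAr⟩
    refine ⟨⟨hA, hAc⟩, hAr, ?_⟩
    by_contra hbad
    have := card_le_of_bad hf hG hrG hF hr hrq hA hbad
    omega

/-- **The `(R6a)` constant one rank up, generic half**: on the core, for a rank-`5` flat `F` with `|F ∩ G| ≥ 17` points
of the rank-`q` set `G` (`q ≥ 6`), `20·C(s, 6) ≤ 20·#goodSets + 50·C(s, 4) + 2·C(s, 3)` (`s = |F ∩ G|`). -/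
theorem twenty_mul_choose_six_le_good {p : ℕ} (hc : Core M p) (h10 : ∀ F ∈ flatsQ M 4, F.card ≤ 10) {G F : Finset α}
    {q : ℕ} (hG : G ⊆ gr M) (hrG : M.eRk (G : Set α) = (q : ℕ∞)) (hq : 6 ≤ q) (hF : F ∈ flatsQ M 5)
    (h17 : 17 ≤ (F ∩ G).card) :
    20 * (F ∩ G).card.choose 6 ≤ 20 * (goodSets M G F q 6 5).card + 50 * (F ∩ G).card.choose 4 +
      2 * (F ∩ G).card.choose 3 := by
  have hbig : 6 + fCore (5 - 1) < (F ∩ G).card := by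
    show 6 + 10 < (F ∩ G).card
    omega
  rw [goodSets_eq_rkSets_of_large (sizeChain_core hc h10 q) hG hrG hF (by norm_num) (by omega) hbig]
  exact twenty_mul_choose_six_le hc h10 hF Finset.inter_subset_left

end PercRepro.Night4
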